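import Summits.ValiantsHypothesis.ValiantsHypothesis.Theorems.LacunarySymmetroidMatrixDescartesCensusTwoRowElbowSix

/-!
# `MatrixDescartes` census — W4: THEOREM O6 for the elbow-6 edge `ZP(6..18)` in the kernel, chamber-uniform

HONEST FRAMING.  Object-search cell `pub-symmetroid`, item `DoorA26 = PosRootLawAt 2 6 19` (stmt-ValiantsHypothesis-19979,
OPEN, typed, never asserted).  Companion of `…CensusTwoRowElbowSix` (edge `6..17`, where the setting is explained): the same
TWO-ROW COVARIANCE KILL (rows `a₀, a₁` against columns `c₃, c₄`, 9 Euler twists, residual tetranomial with at most one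
positive root counted with multiplicity) for the long edge `6..18` of the tropical fan of chamber 1706 — the 13-term edge form
`F = (Σ_{i ≤ 3} aᵢ X^{dᵢ})(c₃X^{d₃} + c₄X^{d₄} + c₅X^{d₅}) − (Σ_{k ∈ {3,4}} b_k X^{d_k})²`, `d₀ = 0` —
on EVERY exponent vector of the chamber (`d₁ < d₂ < 2d₁`, `2d₂ < d₃`, `2d₃ < d₄`, `2d₄ − d₃ < d₅`; the upper facet is not used):
`#Z₊^{mult}(F) ≤ 10 < 12 = #terms − 1`, so no hypothetical twenty on a chamber-1706 support degenerates through the face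
of elbow 6 whose long edge is `6..18` (seat note W4-E1G20 §2; engine-1 g19 TWOROW-E1G19 §3 had it support by support on the 115 box
supports).  The multiplier inequality `twoRow_multiplier_ineq_6_18` is certified by 5 grouped sub-inequalities with
non-negative slack expansions.  Nothing here bounds `ζ_sym(2,6)`, decides `DoorA26`, or bears on `MatrixDescartes`
(stmt-ValiantsHypothesis-18050) / `VP ≠ VNP`.

[folklore] Rolle with multiplicity (Euler twists) + an elementary monotonicity argument; no single source.
-/

-- `Summit.ValiantsHypothesis.ValiantsHypothesis.…` repeats a component by the D-0017 layout
-- (single-conjunct summit), which the `dupNamespace` linter flags; the name is mandated.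
set_option linter.dupNamespace false

namespace Summit.ValiantsHypothesis.ValiantsHypothesis.Theorems.LacunarySymmetroidMatrixDescartes.Census

open Polynomial Finset
open scoped BigOperators Polynomial

/-- The residual tetranomial lemma in the opposite orientation (`A, B < 0 < C₀, D`, `(−B)·C₀ ≤ (−A)·D`):
`#Z₊^{mult}(A X^{n₀} + B X^{n₁} + C₀ X^{n₂} + D X^{n₃}) ≤ 1`. [folklore] -/
theorem countP_posRoots_tetranomial_le_one_neg_18 (A B C₀ D : ℝ) (hA : A < 0) (hB : B < 0) (hC : 0 < C₀) (hD : 0 < D)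
    (hmono : (-B) * C₀ ≤ (-A) * D) {n₀ n₁ n₂ n₃ g δ : ℕ} (hg : 0 < g) (hδ : 0 < δ)
    (h₁ : n₁ = n₀ + g) (h₂ : n₂ = n₀ + δ) (h₃ : n₃ = n₀ + g + δ) :
    (C A * X ^ n₀ + C B * X ^ n₁ + C C₀ * X ^ n₂ + C D * X ^ n₃ : ℝ[X]).roots.countP (fun x => 0 < x) ≤ 1 := by
  have h := countP_posRoots_tetranomial_le_one (-A) (-B) (-C₀) (-D) (by linarith) (by linarith) (by linarith)
    (by linarith) (by simpa using hmono) hg hδ h₁ h₂ h₃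
  rw [← countP_posRoots_neg]
  have e : -(C A * X ^ n₀ + C B * X ^ n₁ + C C₀ * X ^ n₂ + C D * X ^ n₃ : ℝ[X])
      = C (-A) * X ^ n₀ + C (-B) * X ^ n₁ + C (-C₀) * X ^ n₂ + C (-D) * X ^ n₃ := by
    simp only [map_neg]; ring
  rw [e]; exact h

set_option maxHeartbeats 800000 in
-- 18-factor products on each side: the atom bookkeeping exceeds the default budget
/-- **Multiplier inequality for `ZP(6..18)`, rows `(0,1)`, columns `{3,4}`**, in the slack coordinates of chamber 1706
(`p = d₂−d₁`, `q = 2d₁−d₂`, `r = d₃−2d₂`, `s = d₄−2d₃`, `v = d₅−2d₄+d₃`): `|M₀₄|·|M₁₃| ≤ |M₀₃|·|M₁₄|` written with every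
factor a positive linear form (`ν₄ ≤ ν₃`; seat note W4-E1G20 §2). [folklore] -/
theorem twoRow_multiplier_ineq_6_18 (p q r s v : ℝ) (hp : 0 < p) (hq : 0 < q) (hr : 0 < r) (hs : 0 < s)
    (hv : 0 < v) :
    ((2 * p + q + r + s) * (s) * (2 * p + q) * (4 * p + 2 * q + r) * (4 * p + 2 * q + r + s + v) * (5 * p + 3 * q + r + s + v) * (6 * p + 3 * q + r + s + v) * (8 * p + 4 * q + 2 * r + s) * (8 * p + 4 * q + 2 * r + s + v))
      * ((p) * (3 * p + q + r) * (5 * p + 2 * q + r + s) * (7 * p + 3 * q + 2 * r + s) * (7 * p + 3 * q + 2 * r + 2 * s + v) * (8 * p + 4 * q + 2 * r + 2 * s + v) * (9 * p + 4 * q + 2 * r + 2 * s + v) * (11 * p + 5 * q + 3 * r + 2 * s) * (11 * p + 5 * q + 3 * r + 2 * s + v))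
    ≤ ((2 * p + q) * (4 * p + 2 * q + r) * (6 * p + 3 * q + r + s) * (8 * p + 4 * q + 2 * r + s) * (8 * p + 4 * q + 2 * r + 2 * s + v) * (9 * p + 5 * q + 2 * r + 2 * s + v) * (10 * p + 5 * q + 2 * r + 2 * s + v) * (12 * p + 6 * q + 3 * r + 2 * s) * (12 * p + 6 * q + 3 * r + 2 * s + v))
      * ((3 * p + 2 * q + r + s) * (p + q + s) * (p) * (3 * p + q + r) * (3 * p + q + r + s + v) * (4 * p + 2 * q + r + s + v) * (5 * p + 2 * q + r + s + v) * (7 * p + 3 * q + 2 * r + s) * (7 * p + 3 * q + 2 * r + s + v)) := by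
  have g1 : (7 * p + 3 * q + 2 * r + 2 * s + v) ≤ (9 * p + 5 * q + 2 * r + 2 * s + v) := by linarith
  have g2 : (6 * p + 3 * q + r + s + v) * (5 * p + 2 * q + r + s)
      ≤ (6 * p + 3 * q + r + s) * (5 * p + 2 * q + r + s + v) := by
    have hd : (6 * p + 3 * q + r + s) * (5 * p + 2 * q + r + s + v)
        - (6 * p + 3 * q + r + s + v) * (5 * p + 2 * q + r + s)
        = q * v + p * v := by
      ring
    have hnn : 0 ≤ q * v + p * v := by positivity
    linarith
  have g3 : (9 * p + 4 * q + 2 * r + 2 * s + v) ≤ (10 * p + 5 * q + 2 * r + 2 * s + v) := by linarith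
  have g4 : (8 * p + 4 * q + 2 * r + s + v) * (11 * p + 5 * q + 3 * r + 2 * s + v) * (11 * p + 5 * q + 3 * r + 2 * s)
      ≤ (12 * p + 6 * q + 3 * r + 2 * s + v) * (12 * p + 6 * q + 3 * r + 2 * s) * (7 * p + 3 * q + 2 * r + s + v) := by
    have hd : (12 * p + 6 * q + 3 * r + 2 * s + v) * (12 * p + 6 * q + 3 * r + 2 * s) * (7 * p + 3 * q + 2 * r + s + v)
        - (8 * p + 4 * q + 2 * r + s + v) * (11 * p + 5 * q + 3 * r + 2 * s + v) * (11 * p + 5 * q + 3 * r + 2 * s)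
        = q * v ^ 2 + 3 * q * s * v + 5 * q * r * v + 2 * q * r * s + 3 * q * r ^ 2 + 9 * q ^ 2 * v + 3 * q ^ 2 * s + 10 * q ^ 2 * r + 8 * q ^ 3 + p * v ^ 2 + 3 * p * s * v + 5 * p * r * v + 2 * p * r * s + 3 * p * r ^ 2 + 28 * p * q * v + 10 * p * q * s + 32 * p * q * r + 44 * p * q ^ 2 + 19 * p ^ 2 * v + 7 * p ^ 2 * s + 22 * p ^ 2 * r + 76 * p ^ 2 * q + 40 * p ^ 3 := by
      ring
    have hnn : 0 ≤ q * v ^ 2 + 3 * q * s * v + 5 * q * r * v + 2 * q * r * s + 3 * q * r ^ 2 + 9 * q ^ 2 * v + 3 * q ^ 2 * s + 10 * q ^ 2 * r + 8 * q ^ 3 + p * v ^ 2 + 3 * p * s * v + 5 * p * r * v + 2 * p * r * s + 3 * p * r ^ 2 + 28 * p * q * v + 10 * p * q * s + 32 * p * q * r + 44 * p * q ^ 2 + 19 * p ^ 2 * v + 7 * p ^ 2 * s + 22 * p ^ 2 * r + 76 * p ^ 2 * q + 40 * p ^ 3 := by positivity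
    linarith
  have g5 : (5 * p + 3 * q + r + s + v) * (2 * p + q + r + s) * (s)
      ≤ (3 * p + q + r + s + v) * (3 * p + 2 * q + r + s) * (p + q + s) := by
    have hd : (3 * p + q + r + s + v) * (3 * p + 2 * q + r + s) * (p + q + s)
        - (5 * p + 3 * q + r + s + v) * (2 * p + q + r + s) * (s)
        = 2 * q * s * v + q * r * v + q * r * s + q * r ^ 2 + 2 * q ^ 2 * v + 2 * q ^ 2 * s + 3 * q ^ 2 * r + 2 * q ^ 3 + 2 * p * s * v + p * r * v + p * r * s + p * r ^ 2 + 5 * p * q * v + 7 * p * q * s + 9 * p * q * r + 11 * p * q ^ 2 + 3 * p ^ 2 * v + 5 * p ^ 2 * s + 6 * p ^ 2 * r + 18 * p ^ 2 * q + 9 * p ^ 3 := by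
      ring
    have hnn : 0 ≤ 2 * q * s * v + q * r * v + q * r * s + q * r ^ 2 + 2 * q ^ 2 * v + 2 * q ^ 2 * s + 3 * q ^ 2 * r + 2 * q ^ 3 + 2 * p * s * v + p * r * v + p * r * s + p * r ^ 2 + 5 * p * q * v + 7 * p * q * s + 9 * p * q * r + 11 * p * q ^ 2 + 3 * p ^ 2 * v + 5 * p ^ 2 * s + 6 * p ^ 2 * r + 18 * p ^ 2 * q + 9 * p ^ 3 := by positivity
    linarith
  -- turn the linear forms into atoms, then regroup (cheap `ring` on atoms) and compare group by group
  have pf0 : 0 < 2 * p + q := by positivity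
  have pf1 : 0 < 4 * p + 2 * q + r := by positivity
  have pf2 : 0 < 6 * p + 3 * q + r + s := by positivity
  have pf3 : 0 < 8 * p + 4 * q + 2 * r + s := by positivity
  have pf4 : 0 < 8 * p + 4 * q + 2 * r + 2 * s + v := by positivity
  have pf5 : 0 < 9 * p + 5 * q + 2 * r + 2 * s + v := by positivity
  have pf6 : 0 < 10 * p + 5 * q + 2 * r + 2 * s + v := by positivity
  have pf7 : 0 < 12 * p + 6 * q + 3 * r + 2 * s := by positivity
  have pf8 : 0 < 12 * p + 6 * q + 3 * r + 2 * s + v := by positivity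
  have pf9 : 0 < 2 * p + q + r + s := by positivity
  have pf10 : 0 < 4 * p + 2 * q + r + s + v := by positivity
  have pf11 : 0 < 5 * p + 3 * q + r + s + v := by positivity
  have pf12 : 0 < 6 * p + 3 * q + r + s + v := by positivity
  have pf13 : 0 < 8 * p + 4 * q + 2 * r + s + v := by positivity
  have pf14 : 0 < 3 * p + q + r := by positivity
  have pf15 : 0 < 5 * p + 2 * q + r + s := by positivity
  have pf16 : 0 < 7 * p + 3 * q + 2 * r + s := by positivity
  have pf17 : 0 < 7 * p + 3 * q + 2 * r + 2 * s + v := by positivity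
  have pf18 : 0 < 9 * p + 4 * q + 2 * r + 2 * s + v := by positivity
  have pf19 : 0 < 11 * p + 5 * q + 3 * r + 2 * s := by positivity
  have pf20 : 0 < 11 * p + 5 * q + 3 * r + 2 * s + v := by positivity
  have pf21 : 0 < 3 * p + 2 * q + r + s := by positivity
  have pf22 : 0 < p + q + s := by positivity
  have pf23 : 0 < 3 * p + q + r + s + v := by positivity
  have pf24 : 0 < 5 * p + 2 * q + r + s + v := by positivity
  have pf25 : 0 < 7 * p + 3 * q + 2 * r + s + v := by positivity
  generalize hf6 : 10 * p + 5 * q + 2 * r + 2 * s + v = f6 at *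
  generalize hf8 : 12 * p + 6 * q + 3 * r + 2 * s + v = f8 at *
  generalize hf20 : 11 * p + 5 * q + 3 * r + 2 * s + v = f20 at *
  generalize hf4 : 8 * p + 4 * q + 2 * r + 2 * s + v = f4 at *
  generalize hf5 : 9 * p + 5 * q + 2 * r + 2 * s + v = f5 at *
  generalize hf17 : 7 * p + 3 * q + 2 * r + 2 * s + v = f17 at *
  generalize hf18 : 9 * p + 4 * q + 2 * r + 2 * s + v = f18 at *
  generalize hf7 : 12 * p + 6 * q + 3 * r + 2 * s = f7 at *
  generalize hf19 : 11 * p + 5 * q + 3 * r + 2 * s = f19 at *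
  generalize hf13 : 8 * p + 4 * q + 2 * r + s + v = f13 at *
  generalize hf25 : 7 * p + 3 * q + 2 * r + s + v = f25 at *
  generalize hf3 : 8 * p + 4 * q + 2 * r + s = f3 at *
  generalize hf10 : 4 * p + 2 * q + r + s + v = f10 at *
  generalize hf11 : 5 * p + 3 * q + r + s + v = f11 at *
  generalize hf12 : 6 * p + 3 * q + r + s + v = f12 at *
  generalize hf16 : 7 * p + 3 * q + 2 * r + s = f16 at *
  generalize hf24 : 5 * p + 2 * q + r + s + v = f24 at *
  generalize hf2 : 6 * p + 3 * q + r + s = f2 at *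
  generalize hf15 : 5 * p + 2 * q + r + s = f15 at *
  generalize hf21 : 3 * p + 2 * q + r + s = f21 at *
  generalize hf23 : 3 * p + q + r + s + v = f23 at *
  generalize hf1 : 4 * p + 2 * q + r = f1 at *
  generalize hf9 : 2 * p + q + r + s = f9 at *
  generalize hf14 : 3 * p + q + r = f14 at *
  generalize hf0 : 2 * p + q = f0 at *
  generalize hf22 : p + q + s = f22 at *
  have eR : f9 * s * f0 * f1 * f10 * f11 * f12 * f3 * f13 * (p * f14 * f15 * f16 * f17 * f4 * f18 * f19 * f20)
      = (f4 * f0 * f1 * f3 * f10 * p * f14 * f16) * ((f17) * ((f12 * f15) * ((f18) * ((f13 * f20 * f19) * ((f11 * f9 * s)))))) := by ring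
  have eL : f0 * f1 * f2 * f3 * f4 * f5 * f6 * f7 * f8 * (f21 * f22 * p * f14 * f23 * f10 * f24 * f16 * f25)
      = (f4 * f0 * f1 * f3 * f10 * p * f14 * f16) * ((f5) * ((f2 * f24) * ((f6) * ((f8 * f7 * f25) * ((f23 * f21 * f22)))))) := by ring
  rw [eR, eL]
  gcongr

set_option maxHeartbeats 800000 in
-- one declaration carries the 13-term bookkeeping (sum form, 9 twists, four 9-factor multipliers): above the default budget
/-- **THEOREM O6, edge `6..18` (chamber-uniform two-row covariance kill).**  For every exponent vector of chamber 1706 and all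
real coefficients with the cell's signs on the four kept terms (`a₀c₃, a₀c₄ > 0 > a₁c₃, a₁c₄`; the other letters arbitrary), the
13-term edge form of the long edge `6..18` has at most `10 < 12 = #terms − 1` positive roots counted with multiplicity. [folklore] -/
theorem countP_posRoots_zp_6_18_le (d₁ d₂ d₃ d₄ d₅ : ℕ) (h₁ : d₁ < d₂) (h₂ : d₂ < 2 * d₁) (h₃ : 2 * d₂ < d₃)
    (h₄ : 2 * d₃ < d₄) (h₅ : 2 * d₄ < d₃ + d₅) (a₀ a₁ a₂ a₃ c₃ c₄ c₅ b₃ b₄ : ℝ) (s₀₃ : 0 < a₀ * c₃)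
    (s₀₄ : 0 < a₀ * c₄) (s₁₃ : a₁ * c₃ < 0) (s₁₄ : a₁ * c₄ < 0) :
    (((C a₀ + C a₁ * X ^ d₁ + C a₂ * X ^ d₂ + C a₃ * X ^ d₃) * (C c₃ * X ^ d₃ + C c₄ * X ^ d₄ + C c₅ * X ^ d₅)
        - (C b₃ * X ^ d₃ + C b₄ * X ^ d₄) ^ 2 : ℝ[X]).roots.countP (fun x => 0 < x)) ≤ 10 := by
  classical
  have hg : 0 < d₄ - d₃ := by omega
  have hδ : 0 < d₁ := by omega
  have hn₁ : d₄ = d₃ + (d₄ - d₃) := by omega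
  have hn₂ : d₁ + d₃ = d₃ + d₁ := by omega
  have hn₃ : d₁ + d₄ = d₃ + (d₄ - d₃) + d₁ := by omega
  set e : ℕ → ℕ := fun t => match t with
    | 0 => d₃ | 1 => d₄ | 2 => d₁ + d₃ | 3 => d₁ + d₄ | 4 => d₂ + d₃ | 5 => 2 * d₃ | 6 => d₂ + d₄ | 7 => d₃ + d₄ | 8 => d₅ | 9 => d₁ + d₅ | 10 => d₂ + d₅ | 11 => 2 * d₄ | 12 => d₃ + d₅ | _ => 0 with he
  set c : ℕ → ℝ := fun t => match t with
    | 0 => a₀ * c₃ | 1 => a₀ * c₄ | 2 => a₁ * c₃ | 3 => a₁ * c₄ | 4 => a₂ * c₃ | 5 => a₃ * c₃ - (b₃ ^ 2) | 6 => a₂ * c₄ | 7 => a₃ * c₄ - (b₃ * b₄ + b₃ * b₄) | 8 => a₀ * c₅ | 9 => a₁ * c₅ | 10 => a₂ * c₅ | 11 => -(b₄ ^ 2) | 12 => a₃ * c₅ | _ => 0 with hc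
  have hF : ((C a₀ + C a₁ * X ^ d₁ + C a₂ * X ^ d₂ + C a₃ * X ^ d₃) * (C c₃ * X ^ d₃ + C c₄ * X ^ d₄ + C c₅ * X ^ d₅)
        - (C b₃ * X ^ d₃ + C b₄ * X ^ d₄) ^ 2 : ℝ[X]) = ∑ t ∈ range 13, C (c t) * X ^ (e t) := by
    simp only [Finset.sum_range_succ, Finset.sum_range_zero, zero_add, he, hc, map_mul, map_neg,
      map_pow, map_add, pow_add, two_mul, sub_eq_add_neg]
    ring
  rw [hF]
  have step := countP_posRoots_le_countP_twists 13 e c (Ico 4 13)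
  have hcard : (Ico 4 13).card = 9 := by simp
  rw [hcard] at step
  obtain ⟨M, hM⟩ : ∃ M : ℕ → ℝ, ∀ t, M t = ∏ u ∈ Ico 4 13, ((e t : ℝ) - e u) := ⟨_, fun _ => rfl⟩
  have hres : (∑ t ∈ range 13, C (c t * ∏ u ∈ Ico 4 13, ((e t : ℝ) - e u)) * X ^ (e t) : ℝ[X])
      = C (c 0 * M 0) * X ^ (e 0) + C (c 1 * M 1) * X ^ (e 1) + C (c 2 * M 2) * X ^ (e 2)
        + C (c 3 * M 3) * X ^ (e 3) := by
    rw [Finset.range_eq_Ico, ← Finset.sum_Ico_consecutive _ (show 0 ≤ 4 by norm_num) (show 4 ≤ 13 by norm_num)]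
    have hz : (∑ t ∈ Ico 4 13, C (c t * ∏ u ∈ Ico 4 13, ((e t : ℝ) - e u)) * X ^ (e t) : ℝ[X]) = 0 := by
      refine Finset.sum_eq_zero fun t ht => ?_
      rw [Finset.prod_eq_zero ht (sub_self _), mul_zero, map_zero, zero_mul]
    rw [hz, add_zero, Nat.Ico_zero_eq_range]
    simp only [Finset.sum_range_succ, Finset.sum_range_zero, zero_add, ← hM]
  rw [hres] at step
  have e0 : e 0 = d₃ := rfl
  have e1 : e 1 = d₄ := rfl
  have e2 : e 2 = d₁ + d₃ := rfl
  have e3 : e 3 = d₁ + d₄ := rfl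
  have c0 : c 0 = a₀ * c₃ := rfl
  have c1 : c 1 = a₀ * c₄ := rfl
  have c2 : c 2 = a₁ * c₃ := rfl
  have c3 : c 3 = a₁ * c₄ := rfl
  rw [e0, e1, e2, e3, c0, c1, c2, c3] at step
  have r₁ : (d₁ : ℝ) < d₂ := by exact_mod_cast h₁
  have r₂ : (d₂ : ℝ) < 2 * d₁ := by exact_mod_cast h₂
  have r₃ : 2 * (d₂ : ℝ) < d₃ := by exact_mod_cast h₃
  have r₄ : 2 * (d₃ : ℝ) < d₄ := by exact_mod_cast h₄
  have r₅ : 2 * (d₄ : ℝ) < d₃ + d₅ := by exact_mod_cast h₅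
  set p : ℝ := (d₂ : ℝ) - d₁ with hp
  set q : ℝ := 2 * (d₁ : ℝ) - d₂ with hq
  set r : ℝ := (d₃ : ℝ) - 2 * d₂ with hr
  set s : ℝ := (d₄ : ℝ) - 2 * d₃ with hs
  set v : ℝ := (d₅ : ℝ) - 2 * d₄ + d₃ with hv
  have pp : 0 < p := by rw [hp]; linarith
  have qp : 0 < q := by rw [hq]; linarith
  have rp : 0 < r := by rw [hr]; linarith
  have sp : 0 < s := by rw [hs]; linarith
  have vp : 0 < v := by rw [hv]; linarith
  have unroll : ∀ t, M t = ((e t : ℝ) - e 4) * ((e t : ℝ) - e 5) * ((e t : ℝ) - e 6) * ((e t : ℝ) - e 7) * ((e t : ℝ) - e 8) * ((e t : ℝ) - e 9) * ((e t : ℝ) - e 10) * ((e t : ℝ) - e 11) * ((e t : ℝ) - e 12) := by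
    intro t
    rw [hM, Finset.prod_Ico_eq_prod_range]
    simp only [show (13 : ℕ) - 4 = 9 by norm_num, Finset.prod_range_succ, Finset.prod_range_zero, one_mul,
      Nat.reduceAdd]
  have e4 : e 4 = d₂ + d₃ := rfl
  have e5 : e 5 = 2 * d₃ := rfl
  have e6 : e 6 = d₂ + d₄ := rfl
  have e7 : e 7 = d₃ + d₄ := rfl
  have e8 : e 8 = d₅ := rfl
  have e9 : e 9 = d₁ + d₅ := rfl
  have e10 : e 10 = d₂ + d₅ := rfl
  have e11 : e 11 = 2 * d₄ := rfl
  have e12 : e 12 = d₃ + d₅ := rfl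
  have hM0 : M 0 = -((2 * p + q) * (4 * p + 2 * q + r) * (6 * p + 3 * q + r + s) * (8 * p + 4 * q + 2 * r + s) * (8 * p + 4 * q + 2 * r + 2 * s + v) * (9 * p + 5 * q + 2 * r + 2 * s + v) * (10 * p + 5 * q + 2 * r + 2 * s + v) * (12 * p + 6 * q + 3 * r + 2 * s) * (12 * p + 6 * q + 3 * r + 2 * s + v)) := by
    rw [unroll, e0, e4, e5, e6, e7, e8, e9, e10, e11, e12, hp, hq, hr, hs, hv]; push_cast; ring
  have hM1 : M 1 = -((2 * p + q + r + s) * (s) * (2 * p + q) * (4 * p + 2 * q + r) * (4 * p + 2 * q + r + s + v) * (5 * p + 3 * q + r + s + v) * (6 * p + 3 * q + r + s + v) * (8 * p + 4 * q + 2 * r + s) * (8 * p + 4 * q + 2 * r + s + v)) := by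
    rw [unroll, e1, e4, e5, e6, e7, e8, e9, e10, e11, e12, hp, hq, hr, hs, hv]; push_cast; ring
  have hM2 : M 2 = -((p) * (3 * p + q + r) * (5 * p + 2 * q + r + s) * (7 * p + 3 * q + 2 * r + s) * (7 * p + 3 * q + 2 * r + 2 * s + v) * (8 * p + 4 * q + 2 * r + 2 * s + v) * (9 * p + 4 * q + 2 * r + 2 * s + v) * (11 * p + 5 * q + 3 * r + 2 * s) * (11 * p + 5 * q + 3 * r + 2 * s + v)) := by
    rw [unroll, e2, e4, e5, e6, e7, e8, e9, e10, e11, e12, hp, hq, hr, hs, hv]; push_cast; ring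
  have hM3 : M 3 = -((3 * p + 2 * q + r + s) * (p + q + s) * (p) * (3 * p + q + r) * (3 * p + q + r + s + v) * (4 * p + 2 * q + r + s + v) * (5 * p + 2 * q + r + s + v) * (7 * p + 3 * q + 2 * r + s) * (7 * p + 3 * q + 2 * r + s + v)) := by
    rw [unroll, e3, e4, e5, e6, e7, e8, e9, e10, e11, e12, hp, hq, hr, hs, hv]; push_cast; ring
  have M0n : M 0 < 0 := by rw [hM0]; apply neg_neg_of_pos; positivity
  have M1n : M 1 < 0 := by rw [hM1]; apply neg_neg_of_pos; positivity
  have M2n : M 2 < 0 := by rw [hM2]; apply neg_neg_of_pos; positivity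
  have M3n : M 3 < 0 := by rw [hM3]; apply neg_neg_of_pos; positivity
  have nM0 : -M 0 = (2 * p + q) * (4 * p + 2 * q + r) * (6 * p + 3 * q + r + s) * (8 * p + 4 * q + 2 * r + s) * (8 * p + 4 * q + 2 * r + 2 * s + v) * (9 * p + 5 * q + 2 * r + 2 * s + v) * (10 * p + 5 * q + 2 * r + 2 * s + v) * (12 * p + 6 * q + 3 * r + 2 * s) * (12 * p + 6 * q + 3 * r + 2 * s + v) := by rw [hM0, neg_neg]
  have nM1 : -M 1 = (2 * p + q + r + s) * (s) * (2 * p + q) * (4 * p + 2 * q + r) * (4 * p + 2 * q + r + s + v) * (5 * p + 3 * q + r + s + v) * (6 * p + 3 * q + r + s + v) * (8 * p + 4 * q + 2 * r + s) * (8 * p + 4 * q + 2 * r + s + v) := by rw [hM1, neg_neg]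
  have nM2 : -M 2 = (p) * (3 * p + q + r) * (5 * p + 2 * q + r + s) * (7 * p + 3 * q + 2 * r + s) * (7 * p + 3 * q + 2 * r + 2 * s + v) * (8 * p + 4 * q + 2 * r + 2 * s + v) * (9 * p + 4 * q + 2 * r + 2 * s + v) * (11 * p + 5 * q + 3 * r + 2 * s) * (11 * p + 5 * q + 3 * r + 2 * s + v) := by rw [hM2, neg_neg]
  have nM3 : -M 3 = (3 * p + 2 * q + r + s) * (p + q + s) * (p) * (3 * p + q + r) * (3 * p + q + r + s + v) * (4 * p + 2 * q + r + s + v) * (5 * p + 2 * q + r + s + v) * (7 * p + 3 * q + 2 * r + s) * (7 * p + 3 * q + 2 * r + s + v) := by rw [hM3, neg_neg]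
  have K2 : (-M 1) * (-M 2) ≤ (-M 0) * (-M 3) := by
    have K2' := twoRow_multiplier_ineq_6_18 p q r s v pp qp rp sp vp
    rw [← nM0, ← nM1, ← nM2, ← nM3] at K2'
    exact K2'
  have hA : a₀ * c₃ * M 0 < 0 := mul_neg_of_pos_of_neg s₀₃ M0n
  have hB : a₀ * c₄ * M 1 < 0 := mul_neg_of_pos_of_neg s₀₄ M1n
  have hC : 0 < a₁ * c₃ * M 2 := mul_pos_of_neg_of_neg s₁₃ M2n
  have hD : 0 < a₁ * c₄ * M 3 := mul_pos_of_neg_of_neg s₁₄ M3n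
  have hmono : -(a₀ * c₄ * M 1) * (a₁ * c₃ * M 2) ≤ -(a₀ * c₃ * M 0) * (a₁ * c₄ * M 3) := by
    have iden : -(a₀ * c₃ * M 0) * (a₁ * c₄ * M 3) - -(a₀ * c₄ * M 1) * (a₁ * c₃ * M 2)
        = (a₀ * c₄ * -(a₁ * c₃)) * ((-M 0) * (-M 3) - (-M 1) * (-M 2)) := by ring
    have hk : 0 ≤ a₀ * c₄ * -(a₁ * c₃) := mul_nonneg s₀₄.le (neg_nonneg.2 s₁₃.le)
    rw [← sub_nonneg, iden]
    exact mul_nonneg hk (sub_nonneg.2 K2)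
  have tet : ((C (a₀ * c₃ * M 0) * X ^ d₃ + C (a₀ * c₄ * M 1) * X ^ d₄ + C (a₁ * c₃ * M 2) * X ^ (d₁ + d₃)
      + C (a₁ * c₄ * M 3) * X ^ (d₁ + d₄) : ℝ[X]).roots.countP (fun x => 0 < x)) ≤ 1 :=
    countP_posRoots_tetranomial_le_one_neg_18 _ _ _ _ hA hB hC hD hmono (g := d₄ - d₃) (δ := d₁)
      hg hδ hn₁ hn₂ hn₃
  exact step.trans (Nat.add_le_add_right tet _)

end Summit.ValiantsHypothesis.ValiantsHypothesis.Theorems.LacunarySymmetroidMatrixDescartes.Census
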